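import Summits.AtomisticToContinuum.BoseEinsteinCondensation.Theorems.BECPhaseQuadratureSumRuleSumRuleChainGlueStructure
import Summits.AtomisticToContinuum.BoseEinsteinCondensation.Theorems.BECInsertionCorrectorCorrectorClosureFirstCorrectorBoundFourier
import HarnessLib

/-!
# Crux `CorrectorClosure` (stmt-AtomisticToContinuum-12058), line `volume-homotopy-sum-rule-domination` —
# registered stub `stub_longWaveStructureOfSRB`, auxiliary file 2/4: Parseval in the centre of the
# sliding box, per configuration

Supports (does not close) stmt-AtomisticToContinuum-12058, route `BECInsertionCorrector`.

For `N` points `X ∈ [0,L)^{3N}` of the torus of side `L > 0` and periodised sliding boxes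
`Λ_ℓ(u) = u + [-ℓ/2, ℓ/2]³` with `ℓ ≤ L`, the `u`-integral over the cell of the squared box count
`G(u, X) = Σⱼ Σ_{m∈ℤ³} 1[xⱼ + Lm ∈ Λ_ℓ(u)]` is an exact mode sum (`lintegral_boxCount_sq_eq_tsum`):

  `∫_cell G(u, X)² du = L⁻³ Σ_{p ∈ ℤ³} |B_p|² |Σⱼ e_p(xⱼ)|²`,

`B_p = ∫_{Λ_ℓ(0)} conj e_p` the box integral of the plane wave `e_p(u) = e^{2πi p·u/L}`.  Mechanism: on
the cell the box count equals the finite near-image sum `g_X(u) = Σⱼ Σ_{n ∈ {-1,0,1}³} 1[u ∈ Λ_ℓ(xⱼ - Ln)]`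
(`boxCount_eq_ofReal_nearSum`; far images miss the cell as soon as `ℓ ≤ L`,
`not_mem_slidingBox_of_far_le`), whose cell Fourier coefficients are `L⁻³ conj(Σⱼ e_p(xⱼ)) B_p`
(`setIntegral_conj_cellWave_nearSum`, tiling), so PARSEVAL on the cell for the bounded measurable `g_X`
(`hasSum_sq_cellFourierCoeff_of_bound`) gives the identity (`hasSum_sq_boxCoeff_densityWave`, real
`HasSum` form; `lintegral_boxCount_sq_eq_tsum`, `[0, ∞]` form).  The sibling file
`…SumRuleChainGlueStructure` proves the Bessel direction for `ℓ < L`; here equality is needed, and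
`ℓ = L` is allowed.

## References

* [PitaevskiiStringari1991] L. Pitaevskii, S. Stringari, *Uncertainty principle, quantum fluctuations
  and broken symmetries*, J. Low Temp. Phys. 85 (1991), (8)–(11) (box number fluctuations through the
  structure factor).
-/

noncomputable section

open MeasureTheory Filter Set Complex
open scoped ENNReal NNReal Topology ComplexConjugate BigOperators

namespace Summit.AtomisticToContinuum.BoseEinsteinCondensation.Theorems.CorrectorClosure.VolumeHomotopySumRuleDomination

open Literature.MathematicalPhysics.QuantumManyBody.BoseGas
open Summit.AtomisticToContinuum.BoseEinsteinCondensation.Theorems.SumRuleChainGlue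
  (mem_nearImages_iff mem_slidingBox_comm tsum_setIntegral_conj_cellWave_box)
open Summit.AtomisticToContinuum.BoseEinsteinCondensation.Theorems.CorrectorClosure.ResidueAreaLaw
  (hasSum_sq_cellFourierCoeff_of_bound)

variable {N : ℕ} {L ℓ : ℝ}

/-! ### Near images: the box count on the cell is a finite sum -/

/-- **Far images miss the cell** (boxes up to the size of the cell): for `x, u ∈ [0,L)³`, `ℓ ≤ L` and
`n ∉ {-1,0,1}³`, `u ∉ Λ_ℓ(x - Ln)`. [folklore] -/
theorem not_mem_slidingBox_of_far_le (hℓL : ℓ ≤ L) {x u : Space} (hx : x ∈ cell L) (hu : u ∈ cell L)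
    {n : Fin 3 → ℤ} (hn : n ∉ Fintype.piFinset (fun _ : Fin 3 => ({-1, 0, 1} : Finset ℤ))) :
    u ∉ slidingBox ℓ (x - latticeVec L n) := by
  -- adapted from `not_mem_slidingBox_of_far` (…SumRuleChainGlueStructure): `ℓ < L` relaxed to `ℓ ≤ L`
  rw [mem_nearImages_iff] at hn
  push Not at hn
  obtain ⟨k, hk1, hk0, hk2⟩ := hn
  intro hmem
  have h := hmem k
  simp only [PiLp.sub_apply, latticeVec_apply, Set.mem_Icc] at h
  have hxk := hx k
  have huk := hu k
  simp only [Set.mem_Ico] at hxk huk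
  have hL : 0 < L := lt_of_le_of_lt hxk.1 hxk.2
  have hn2 : (2 : ℤ) ≤ n k ∨ n k ≤ -2 := by omega
  rcases hn2 with h2 | h2
  · have h2' : (2 : ℝ) ≤ (n k : ℝ) := by exact_mod_cast h2
    have h3 : L * 2 ≤ L * (n k : ℝ) := mul_le_mul_of_nonneg_left h2' hL.le
    linarith [h.1, h.2, hxk.1, hxk.2, huk.1, huk.2]
  · have h2' : (n k : ℝ) ≤ -2 := by exact_mod_cast h2
    have h3 : L * (n k : ℝ) ≤ L * (-2) := mul_le_mul_of_nonneg_left h2' hL.le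
    linarith [h.1, h.2, hxk.1, hxk.2, huk.1, huk.2]

/-- **The box count on the cell is the near-image sum**: for `u ∈ [0,L)³`, `X ∈ [0,L)^{3N}`, `ℓ ≤ L`,
`Σⱼ Σ_{m∈ℤ³} 1[xⱼ + Lm ∈ Λ_ℓ(u)] = Σⱼ Σ_{n∈{-1,0,1}³} 1[u ∈ Λ_ℓ(xⱼ - Ln)]`. [folklore] -/
theorem boxCount_eq_ofReal_nearSum (hℓL : ℓ ≤ L) {X : Config N} (hX : X ∈ cellN N L) {u : Space}
    (hu : u ∈ cell L) :
    (∑ j : Fin N, ∑' m : Fin 3 → ℤ,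
        (slidingBox ℓ u).indicator (fun _ => (1 : ℝ≥0∞)) (X j + latticeVec L m)) =
      ENNReal.ofReal (∑ j : Fin N, ∑ n ∈ Fintype.piFinset (fun _ : Fin 3 => ({-1, 0, 1} : Finset ℤ)),
        (slidingBox ℓ (X j - latticeVec L n)).indicator (fun _ => (1 : ℝ)) u) := by
  classical
  set M := Fintype.piFinset (fun _ : Fin 3 => ({-1, 0, 1} : Finset ℤ)) with hM
  rw [ENNReal.ofReal_sum_of_nonneg fun j _ =>
    Finset.sum_nonneg fun n _ => Set.indicator_nonneg (fun _ _ => zero_le_one) _]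
  refine Finset.sum_congr rfl fun j _ => ?_
  rw [ENNReal.ofReal_sum_of_nonneg fun n _ => Set.indicator_nonneg (fun _ _ => zero_le_one) _]
  -- the term `m` of the box count is the indicator of `Λ_ℓ(xⱼ - L(-m))` at `u`
  have hterm : ∀ m : Fin 3 → ℤ,
      (slidingBox ℓ u).indicator (fun _ => (1 : ℝ≥0∞)) (X j + latticeVec L m) =
        ENNReal.ofReal ((slidingBox ℓ (X j - latticeVec L (-m))).indicator (fun _ => (1 : ℝ)) u) := by
    intro m
    have hiff : X j + latticeVec L m ∈ slidingBox ℓ u ↔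
        u ∈ slidingBox ℓ (X j - latticeVec L (-m)) := by
      rw [mem_slidingBox_comm, latticeVec_neg, sub_neg_eq_add]
    by_cases h : X j + latticeVec L m ∈ slidingBox ℓ u
    · rw [Set.indicator_of_mem h, Set.indicator_of_mem (hiff.1 h), ENNReal.ofReal_one]
    · rw [Set.indicator_of_notMem h, Set.indicator_of_notMem (fun h' => h (hiff.2 h')),
        ENNReal.ofReal_zero]
  simp_rw [hterm]
  -- only the near images `-m ∈ M` contribute
  have hsupp : ∀ m ∉ M.map (Equiv.neg (Fin 3 → ℤ)).toEmbedding,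
      ENNReal.ofReal ((slidingBox ℓ (X j - latticeVec L (-m))).indicator (fun _ => (1 : ℝ)) u) = 0 := by
    intro m hm
    have hm' : -m ∉ M := fun h' => hm (Finset.mem_map.2 ⟨-m, h', by simp⟩)
    rw [Set.indicator_of_notMem (not_mem_slidingBox_of_far_le hℓL (hX j) hu hm'),
      ENNReal.ofReal_zero]
  rw [tsum_eq_sum hsupp, Finset.sum_map]
  refine Finset.sum_congr rfl fun n _ => ?_
  simp only [Equiv.coe_toEmbedding, Equiv.neg_apply, neg_neg]

/-- The near-image sum is non-negative. [folklore] -/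
theorem nearSum_nonneg (ℓ L : ℝ) (X : Config N) (u : Space) :
    0 ≤ ∑ j : Fin N, ∑ n ∈ Fintype.piFinset (fun _ : Fin 3 => ({-1, 0, 1} : Finset ℤ)),
      (slidingBox ℓ (X j - latticeVec L n)).indicator (fun _ => (1 : ℝ)) u :=
  Finset.sum_nonneg fun _ _ => Finset.sum_nonneg fun _ _ =>
    Set.indicator_nonneg (fun _ _ => zero_le_one) _

/-- The near-image sum is at most `27 N`. [folklore] -/
theorem nearSum_le (ℓ L : ℝ) (X : Config N) (u : Space) :
    (∑ j : Fin N, ∑ n ∈ Fintype.piFinset (fun _ : Fin 3 => ({-1, 0, 1} : Finset ℤ)),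
      (slidingBox ℓ (X j - latticeVec L n)).indicator (fun _ => (1 : ℝ)) u) ≤ 27 * N := by
  have hcard : (Fintype.piFinset (fun _ : Fin 3 => ({-1, 0, 1} : Finset ℤ))).card = 27 := by
    rw [Fintype.card_piFinset]
    decide
  calc (∑ j : Fin N, ∑ n ∈ Fintype.piFinset (fun _ : Fin 3 => ({-1, 0, 1} : Finset ℤ)),
        (slidingBox ℓ (X j - latticeVec L n)).indicator (fun _ => (1 : ℝ)) u)
      ≤ ∑ _j : Fin N, ∑ _n ∈ Fintype.piFinset (fun _ : Fin 3 => ({-1, 0, 1} : Finset ℤ)), (1 : ℝ) :=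
        Finset.sum_le_sum fun j _ => Finset.sum_le_sum fun n _ =>
          Set.indicator_le_self' (fun _ _ => zero_le_one) _
    _ = 27 * N := by simp [hcard, mul_comm]

/-- The near-image sum is measurable in `u`. [folklore] -/
theorem measurable_nearSum (ℓ L : ℝ) (X : Config N) :
    Measurable fun u : Space => ∑ j : Fin N,
      ∑ n ∈ Fintype.piFinset (fun _ : Fin 3 => ({-1, 0, 1} : Finset ℤ)),
        (slidingBox ℓ (X j - latticeVec L n)).indicator (fun _ => (1 : ℝ)) u := by
  refine Finset.measurable_sum _ fun j _ => Finset.measurable_sum _ fun n _ => ?_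
  exact measurable_const.indicator (measurableSet_slidingBox _ _)

/-! ### The cell Fourier coefficients of the near-image sum, and Parseval -/

/-- **The cell Fourier coefficients of the near-image sum**: for `X ∈ cell^N` and `ℓ ≤ L`,
`∫_cell conj(e_p) g_X = conj(Σⱼ e_p(xⱼ)) · B_p`, `B_p = ∫_{Λ_ℓ(0)} conj e_p`. [folklore] -/
theorem setIntegral_conj_cellWave_nearSum (hL : 0 < L) (hℓL : ℓ ≤ L) {X : Config N}
    (hX : X ∈ cellN N L) (p : Fin 3 → ℤ) :
    ∫ u in cell L, conj (cellWave L p u) *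
        ((∑ j : Fin N, ∑ n ∈ Fintype.piFinset (fun _ : Fin 3 => ({-1, 0, 1} : Finset ℤ)),
          (slidingBox ℓ (X j - latticeVec L n)).indicator (fun _ => (1 : ℝ)) u : ℝ) : ℂ) =
      conj (∑ j : Fin N, cellWave L p (X j)) * ∫ y in slidingBox ℓ 0, conj (cellWave L p y) := by
  -- adapted from `setIntegral_conj_cellWave_boxMinorant` (…SumRuleChainGlueStructure): `ℓ ≤ L`
  set M := Fintype.piFinset (fun _ : Fin 3 => ({-1, 0, 1} : Finset ℤ)) with hM
  have hpt : ∀ u, conj (cellWave L p u) * ((∑ j : Fin N, ∑ n ∈ M,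
      (slidingBox ℓ (X j - latticeVec L n)).indicator (fun _ => (1 : ℝ)) u : ℝ) : ℂ) =
      ∑ j : Fin N, ∑ n ∈ M,
        (slidingBox ℓ (X j - latticeVec L n)).indicator (fun u => conj (cellWave L p u)) u := by
    intro u
    push_cast
    rw [Finset.mul_sum]
    refine Finset.sum_congr rfl fun j _ => ?_
    rw [Finset.mul_sum]
    refine Finset.sum_congr rfl fun n _ => ?_
    by_cases h : u ∈ slidingBox ℓ (X j - latticeVec L n)
    · rw [Set.indicator_of_mem h, Set.indicator_of_mem h]; push_cast; ring
    · rw [Set.indicator_of_notMem h, Set.indicator_of_notMem h]; push_cast; ring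
  simp_rw [hpt]
  have hint : ∀ j n, IntegrableOn (fun u => (slidingBox ℓ (X j - latticeVec L n)).indicator
      (fun u => conj (cellWave L p u)) u) (cell L) volume := fun j n =>
    (integrableOn_cell (Complex.continuous_conj.comp (continuous_cellWave L p))).indicator
      (measurableSet_slidingBox _ _)
  rw [integral_finsetSum _ fun j _ => integrable_finsetSum _ fun n _ => hint j n, map_sum,
    Finset.sum_mul]
  refine Finset.sum_congr rfl fun j _ => ?_
  rw [integral_finsetSum _ fun n _ => hint j n, ← tsum_setIntegral_conj_cellWave_box hL ℓ p (X j)]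
  symm
  refine tsum_eq_sum fun n hn => ?_
  refine setIntegral_eq_zero_of_forall_eq_zero fun u hu => ?_
  exact Set.indicator_of_notMem (not_mem_slidingBox_of_far_le hℓL (hX j) hu hn) _

/-- **Parseval for the near-image sum, per configuration**: for `X ∈ cell^N` and `ℓ ≤ L`,
`Σ_p |Σⱼ e_p(xⱼ)|² |B_p|² = L³ ∫_cell g_X²` (as a `HasSum`). [folklore] -/
theorem hasSum_sq_boxCoeff_densityWave (hL : 0 < L) (hℓL : ℓ ≤ L) {X : Config N}
    (hX : X ∈ cellN N L) :
    HasSum (fun p : Fin 3 → ℤ => ‖∑ j : Fin N, cellWave L p (X j)‖ ^ 2 *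
        ‖∫ y in slidingBox ℓ 0, conj (cellWave L p y)‖ ^ 2)
      (L ^ 3 * ∫ u in cell L, (∑ j : Fin N,
        ∑ n ∈ Fintype.piFinset (fun _ : Fin 3 => ({-1, 0, 1} : Finset ℤ)),
          (slidingBox ℓ (X j - latticeVec L n)).indicator (fun _ => (1 : ℝ)) u) ^ 2) := by
  set g : Space → ℝ := fun u => ∑ j : Fin N,
    ∑ n ∈ Fintype.piFinset (fun _ : Fin 3 => ({-1, 0, 1} : Finset ℤ)),
      (slidingBox ℓ (X j - latticeVec L n)).indicator (fun _ => (1 : ℝ)) u with hg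
  have hgm : Measurable g := measurable_nearSum ℓ L X
  have hgC : ∀ u, ‖(g u : ℂ)‖ ≤ 27 * N := fun u => by
    rw [Complex.norm_real, Real.norm_of_nonneg (nearSum_nonneg ℓ L X u)]
    exact nearSum_le ℓ L X u
  have hP := hasSum_sq_cellFourierCoeff_of_bound hL (φ := fun u => (g u : ℂ))
    (Complex.measurable_ofReal.comp hgm) hgC
  have hL3 : (0 : ℝ) < L ^ 3 := pow_pos hL 3
  -- the coefficients and the norm
  have hcoef : ∀ p, ‖cellFourierCoeff L (fun u => (g u : ℂ)) p‖ ^ 2 = ((L ^ 3)⁻¹) ^ 2 *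
      (‖∑ j : Fin N, cellWave L p (X j)‖ ^ 2 * ‖∫ y in slidingBox ℓ 0, conj (cellWave L p y)‖ ^ 2) := by
    intro p
    rw [cellFourierCoeff_eq_integral hL, hg, setIntegral_conj_cellWave_nearSum hL hℓL hX p, norm_smul,
      norm_mul, Complex.norm_conj, Real.norm_of_nonneg (by positivity)]
    ring
  have hnorm : ∫ u in cell L, ‖(g u : ℂ)‖ ^ 2 = ∫ u in cell L, g u ^ 2 := by
    refine integral_congr_ae (Eventually.of_forall fun u => ?_)
    show ‖((g u : ℝ) : ℂ)‖ ^ 2 = g u ^ 2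
    rw [Complex.norm_real, Real.norm_eq_abs, sq_abs]
  simp only [hcoef, hnorm] at hP
  have hfun : (fun p : Fin 3 → ℤ => ‖∑ j : Fin N, cellWave L p (X j)‖ ^ 2 *
      ‖∫ y in slidingBox ℓ 0, conj (cellWave L p y)‖ ^ 2) = fun p => L ^ 6 * (((L ^ 3)⁻¹) ^ 2 *
        (‖∑ j : Fin N, cellWave L p (X j)‖ ^ 2 * ‖∫ y in slidingBox ℓ 0, conj (cellWave L p y)‖ ^ 2)) := by
    funext p
    field_simp
  have hval : L ^ 3 * ∫ u in cell L, g u ^ 2 = L ^ 6 * ((L ^ 3)⁻¹ * ∫ u in cell L, g u ^ 2) := by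
    field_simp
  rw [hfun, hval]
  exact hP.mul_left (L ^ 6)

/-- **The `u`-integral of the squared box count, per configuration** (Parseval, in `[0, ∞]`):
for `X ∈ cell^N`, `ℓ ≤ L`,
`∫_cell (Σⱼ Σ_m 1[xⱼ + Lm ∈ Λ_ℓ(u)])² du = L⁻³ Σ_p |B_p|² |Σⱼ e_p(xⱼ)|²`. [folklore] -/
theorem lintegral_boxCount_sq_eq_tsum (hL : 0 < L) (hℓL : ℓ ≤ L) {X : Config N}
    (hX : X ∈ cellN N L) :
    ∫⁻ u in cell L, (∑ j : Fin N, ∑' m : Fin 3 → ℤ,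
        (slidingBox ℓ u).indicator (fun _ => (1 : ℝ≥0∞)) (X j + latticeVec L m)) ^ 2 =
      ENNReal.ofReal ((L ^ 3)⁻¹) * ∑' p : Fin 3 → ℤ,
        ENNReal.ofReal (‖∫ y in slidingBox ℓ 0, conj (cellWave L p y)‖ ^ 2) *
          ENNReal.ofReal (‖∑ j : Fin N, cellWave L p (X j)‖ ^ 2) := by
  set g : Space → ℝ := fun u => ∑ j : Fin N,
    ∑ n ∈ Fintype.piFinset (fun _ : Fin 3 => ({-1, 0, 1} : Finset ℤ)),
      (slidingBox ℓ (X j - latticeVec L n)).indicator (fun _ => (1 : ℝ)) u with hg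
  have hgm : Measurable g := measurable_nearSum ℓ L X
  have hg0 : ∀ u, 0 ≤ g u := nearSum_nonneg ℓ L X
  have hF := hasSum_sq_boxCoeff_densityWave hL hℓL hX
  -- the left-hand side is `ofReal (∫_cell g²)`
  have h1 : ∫⁻ u in cell L, (∑ j : Fin N, ∑' m : Fin 3 → ℤ,
      (slidingBox ℓ u).indicator (fun _ => (1 : ℝ≥0∞)) (X j + latticeVec L m)) ^ 2 =
      ∫⁻ u in cell L, ENNReal.ofReal (g u ^ 2) := by
    refine setLIntegral_congr_fun (measurableSet_cell L) fun u hu => ?_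
    show _ = ENNReal.ofReal (g u ^ 2)
    rw [boxCount_eq_ofReal_nearSum hℓL hX hu, ENNReal.ofReal_pow (hg0 u)]
  have hgi : IntegrableOn (fun u => g u ^ 2) (cell L) volume := by
    refine Measure.integrableOn_of_bounded (M := (27 * (N : ℝ)) ^ 2) ?_
      (hgm.pow_const 2).aestronglyMeasurable (Eventually.of_forall fun u => ?_)
    · rw [volume_cell]; exact ENNReal.pow_ne_top ENNReal.ofReal_ne_top
    · rw [Real.norm_of_nonneg (sq_nonneg _)]
      exact pow_le_pow_left₀ (hg0 u) (nearSum_le ℓ L X u) 2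
  have h2 : ∫⁻ u in cell L, ENNReal.ofReal (g u ^ 2) = ENNReal.ofReal (∫ u in cell L, g u ^ 2) :=
    (ofReal_integral_eq_lintegral_ofReal hgi (Eventually.of_forall fun u => sq_nonneg _)).symm
  -- the right-hand side is `ofReal (L⁻³ · L³ ∫_cell g²)`
  have h3 : ∑' p : Fin 3 → ℤ, ENNReal.ofReal (‖∫ y in slidingBox ℓ 0, conj (cellWave L p y)‖ ^ 2) *
      ENNReal.ofReal (‖∑ j : Fin N, cellWave L p (X j)‖ ^ 2) =
      ENNReal.ofReal (L ^ 3 * ∫ u in cell L, g u ^ 2) := by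
    rw [← hF.tsum_eq, ENNReal.ofReal_tsum_of_nonneg (fun p => by positivity) hF.summable]
    refine tsum_congr fun p => ?_
    rw [← ENNReal.ofReal_mul (by positivity), mul_comm]
  rw [h1, h2, h3, ← ENNReal.ofReal_mul (by positivity)]
  congr 1
  field_simp

end Summit.AtomisticToContinuum.BoseEinsteinCondensation.Theorems.CorrectorClosure.VolumeHomotopySumRuleDomination

end
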